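import Summits.Parity.GeneralizedHardyLittlewood.Theorems.LeeYangFibresCellParityLawP2Defs
import HarnessLib

/-!
# Route `LeeYangFibres`, crux `CellParityLaw` (stmt-Parity-14109), line `section-annihilator`:
# the registered stub `stub_recursionIdentity` — the Buchstab recursion for rough cells

Skeleton v18 (lead c5). This file proves the exact combinatorial identity

  `RecursionIdentity : ∀ 𝒜 x z j, 1 ≤ j → 0 ≤ z →
     roughCellSum 𝒜 x z (j + 1) = Σ_{p ≤ x prime, z < p} roughCellSum (fibreSeq 𝒜 p) (x/p) (p − 1/2) j`:

sorting a `z`-rough `q ≤ x` with `Ω(q) = j + 1 ≥ 2` by its least prime factor `p = P⁻(q) > z` is a bijection onto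
the pairs `(p, m)` with `p` prime, `z < p ≤ x`, `m = q/p ≤ x/p`, `Ω(m) = j` and `P⁻(m) ≥ p` (i.e. `> p − 1/2`),
the inverse being `(p, m) ↦ p m` (then `P⁻(pm) = p`). No hypothesis on the sequence is used (`0 ≤ z` is not
needed either). This is the `q ↔ (P⁻(q), q/P⁻(q))` step of Buchstab's identity
`Φ(x, y) = 1 + Σ_{y ≤ p ≤ x} Φ(x/p, p)` (Montgomery–Vaughan (7.43)) restricted to a cell.

References: H. L. Montgomery, R. C. Vaughan, *Multiplicative Number Theory I*, CUP 2007, §7.2 (7.43)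
[MontgomeryVaughan2007].
-/

noncomputable section

open scoped BigOperators Classical
open Finset Literature.NumberTheory.Sieve

namespace Summit.Parity.GeneralizedHardyLittlewood.Cruxes.CellParityLaw.SectionAnnihilator

namespace RecursionAux

/-- A natural number with at least one prime factor counted with multiplicity is neither `0` nor `1`. -/
theorem two_le_of_cardFactors_pos {q : ℕ} (hq0 : q ≠ 0)
    (h : 1 ≤ ArithmeticFunction.cardFactors q) : 2 ≤ q := by
  rcases Nat.lt_or_ge q 2 with hlt | hge
  · interval_cases q
    · exact absurd rfl hq0
    · simp [ArithmeticFunction.cardFactors_one] at h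
  · exact hge

/-- `Ω(p m) = Ω(m) + 1` for a prime `p` and `m ≠ 0`. [folklore] -/
theorem cardFactors_prime_mul {p m : ℕ} (hp : p.Prime) (hm : m ≠ 0) :
    ArithmeticFunction.cardFactors (p * m) = ArithmeticFunction.cardFactors m + 1 := by
  rw [ArithmeticFunction.cardFactors_mul hp.ne_zero hm, ArithmeticFunction.cardFactors_apply_prime hp]
  ring

/-- If every prime factor of `m ≠ 1` is at least `p`, then `p ≤ P⁻(m)`. [folklore] -/
theorem le_minFac_of_forall_prime_dvd {p m : ℕ} (hm1 : m ≠ 1)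
    (h : ∀ r : ℕ, r.Prime → r ∣ m → p ≤ r) : p ≤ m.minFac := by
  rcases Nat.le_minFac.mpr h with h1 | h2
  · exact absurd h1 hm1
  · exact h2

/-- For a prime `p` and `m` with `p ≤ P⁻(m)`: `P⁻(p m) = p`. [folklore] -/
theorem minFac_prime_mul {p m : ℕ} (hp : p.Prime) (hpm : p ≤ m.minFac) :
    (p * m).minFac = p := by
  refine le_antisymm (Nat.minFac_le_of_dvd hp.two_le (dvd_mul_right p m)) ?_
  refine le_minFac_of_forall_prime_dvd ?_ fun r hr hrdvd => ?_
  · intro h1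
    exact hp.one_lt.ne' (Nat.eq_one_of_mul_eq_one_right h1)
  · rcases (Nat.Prime.dvd_mul hr).mp hrdvd with h | h
    · exact ((Nat.prime_dvd_prime_iff_eq hr hp).mp h).ge
    · exact hpm.trans (Nat.minFac_le_of_dvd hr.two_le h)

/-- The integer part of a real threshold: `(p : ℝ) − 1/2 < k ↔ p ≤ k` for naturals. [folklore] -/
theorem sub_half_lt_natCast_iff {p k : ℕ} : (p : ℝ) - 1 / 2 < (k : ℝ) ↔ p ≤ k := by
  constructor
  · intro h
    by_contra hlt
    push Not at hlt
    have : (k : ℝ) + 1 ≤ (p : ℝ) := by exact_mod_cast hlt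
    linarith
  · intro h
    have : (p : ℝ) ≤ (k : ℝ) := by exact_mod_cast h
    linarith

end RecursionAux

open RecursionAux in
/-- **Weighted Buchstab recursion for rough cells.** For every weight `w` on the least prime factor and `j ≥ 1`:
`Σ_{q ≤ x, P⁻(q) > z, Ω(q) = j+1} w(P⁻(q)) a_q = Σ_{z < p ≤ x, p prime} w(p) C_j(𝒜_p; x/p, p − 1/2)`, by the bijection
`q ↦ (P⁻(q), q/P⁻(q))`, `(p, m) ↦ p m`. The case `w = 1` is `RecursionIdentity`; the case `j = 1`,
`w(p) = I_n(log(x/p)/log p)` expresses `weightedPairSum` through the fibres' prime counts. [folklore] -/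
theorem sum_roughCell_succ_eq_sum_fibre (𝒜 : SieveSequence) (x z : ℝ) (j : ℕ) (hj : 1 ≤ j) (w : ℕ → ℝ) :
    ∑ q ∈ (Finset.Ioc 0 ⌊x⌋₊).filter
        (fun q : ℕ => z < (Nat.minFac q : ℝ) ∧ ArithmeticFunction.cardFactors q = j + 1),
        w (Nat.minFac q) * 𝒜.a q =
      ∑ p ∈ (Finset.Ioc 0 ⌊x⌋₊).filter (fun p : ℕ => p.Prime ∧ z < (p : ℝ)),
        w p * roughCellSum (fibreSeq 𝒜 p) (x / p) ((p : ℝ) - 1 / 2) j := by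
  unfold roughCellSum
  -- the right-hand side as a sum over the sigma-finset of pairs `(p, m)`
  set P : Finset ℕ := (Finset.Ioc 0 ⌊x⌋₊).filter (fun p : ℕ => p.Prime ∧ z < (p : ℝ)) with hP
  set M : ℕ → Finset ℕ := fun p => (Finset.Ioc 0 ⌊x / p⌋₊).filter
      (fun m : ℕ => ((p : ℝ) - 1 / 2) < (Nat.minFac m : ℝ) ∧ ArithmeticFunction.cardFactors m = j) with hM
  have hRHS : ∑ p ∈ P, w p * ∑ m ∈ (Finset.Ioc 0 ⌊x / (p : ℝ)⌋₊).filter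
        (fun q : ℕ => ((p : ℝ) - 1 / 2) < (Nat.minFac q : ℝ) ∧ ArithmeticFunction.cardFactors q = j),
        (fibreSeq 𝒜 p).a m = ∑ pm ∈ P.sigma M, w pm.1 * 𝒜.a (pm.1 * pm.2) := by
    rw [Finset.sum_sigma]
    refine Finset.sum_congr rfl fun p _ => ?_
    rw [Finset.mul_sum]
    rfl
  rw [hRHS]
  -- the bijection
  refine Finset.sum_nbij' (fun q : ℕ => (⟨q.minFac, q / q.minFac⟩ : Σ _ : ℕ, ℕ))
    (fun pm : Σ _ : ℕ, ℕ => pm.1 * pm.2) ?_ ?_ ?_ ?_ ?_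
  · -- `q ↦ (P⁻(q), q/P⁻(q))` lands in the pair set
    intro q hq
    simp only [Finset.mem_filter, Finset.mem_Ioc] at hq
    obtain ⟨⟨hq0, hqx⟩, hzq, hΩ⟩ := hq
    have hq2 : 2 ≤ q := two_le_of_cardFactors_pos (by omega) (by omega)
    have hq1 : q ≠ 1 := by omega
    have hp : q.minFac.Prime := Nat.minFac_prime hq1
    have hdvd : q.minFac ∣ q := Nat.minFac_dvd q
    set p := q.minFac with hp_def
    obtain ⟨m, hm⟩ := hdvd
    have hm0 : m ≠ 0 := by rintro rfl; simp at hm; omega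
    have hqm : q / p = m := by rw [hm, Nat.mul_div_cancel_left m hp.pos]
    have hx1 : (1 : ℝ) ≤ x := Nat.floor_pos.mp (by omega)
    have hqxr : (q : ℝ) ≤ x := (Nat.le_floor_iff (by linarith)).mp hqx
    have hp0 : (0 : ℝ) < p := by exact_mod_cast hp.pos
    have hm1 : m ≠ 1 := by
      intro h1
      rw [h1, mul_one] at hm
      rw [hm, ArithmeticFunction.cardFactors_apply_prime hp] at hΩ
      omega
    rw [Finset.mem_sigma]
    refine ⟨?_, ?_⟩
    · simp only [hP, Finset.mem_filter, Finset.mem_Ioc]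
      exact ⟨⟨hp.pos, (Nat.minFac_le (by omega)).trans hqx⟩, hp, hzq⟩
    · simp only [hM, Finset.mem_filter, Finset.mem_Ioc, hqm]
      refine ⟨⟨Nat.pos_of_ne_zero hm0, ?_⟩, ?_, ?_⟩
      · refine (Nat.le_floor_iff (by positivity)).mpr ?_
        rw [le_div_iff₀ hp0]
        calc (m : ℝ) * p = (q : ℝ) := by rw [hm]; push_cast; ring
          _ ≤ x := hqxr
      · refine sub_half_lt_natCast_iff.mpr (le_minFac_of_forall_prime_dvd hm1 fun r hr hrm => ?_)
        exact Nat.minFac_le_of_dvd hr.two_le (hrm.trans (Dvd.intro_left p hm.symm))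
      · have h := cardFactors_prime_mul hp hm0
        rw [← hm] at h
        omega
  · -- `(p, m) ↦ p m` lands in the rough cell
    intro pm hpm
    rw [Finset.mem_sigma] at hpm
    obtain ⟨hp, hm⟩ := hpm
    simp only [hP, Finset.mem_filter, Finset.mem_Ioc] at hp
    simp only [hM, Finset.mem_filter, Finset.mem_Ioc] at hm
    obtain ⟨⟨hp0, hpx⟩, hpp, hzp⟩ := hp
    obtain ⟨⟨hm0, hmx⟩, hminm, hΩm⟩ := hm
    have hm1 : pm.2 ≠ 1 := by
      intro h1; rw [h1, ArithmeticFunction.cardFactors_one] at hΩm; omega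
    have hpm_le : pm.1 ≤ pm.2.minFac := sub_half_lt_natCast_iff.mp hminm
    have hmin : (pm.1 * pm.2).minFac = pm.1 := minFac_prime_mul hpp hpm_le
    have hpr : (0 : ℝ) < pm.1 := by exact_mod_cast hp0
    have hmxr : (pm.2 : ℝ) ≤ x / pm.1 := (Nat.le_floor_iff' (by omega)).mp hmx
    simp only [Finset.mem_filter, Finset.mem_Ioc]
    refine ⟨⟨Nat.mul_pos hp0 hm0, ?_⟩, ?_, ?_⟩
    · refine (Nat.le_floor_iff' (Nat.mul_ne_zero hpp.ne_zero (by omega))).mpr ?_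
      push_cast
      calc (pm.1 : ℝ) * pm.2 ≤ pm.1 * (x / pm.1) := by gcongr
        _ = x := mul_div_cancel₀ x hpr.ne'
    · rw [hmin]; exact hzp
    · rw [cardFactors_prime_mul hpp (by omega), hΩm]
  · -- left inverse
    intro q hq
    exact Nat.mul_div_cancel' (Nat.minFac_dvd q)
  · -- right inverse
    intro pm hpm
    rw [Finset.mem_sigma] at hpm
    obtain ⟨hp, hm⟩ := hpm
    simp only [hP, Finset.mem_filter, Finset.mem_Ioc] at hp
    simp only [hM, Finset.mem_filter, Finset.mem_Ioc] at hm
    obtain ⟨⟨hp0, -⟩, hpp, -⟩ := hp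
    obtain ⟨⟨hm0, -⟩, hminm, hΩm⟩ := hm
    have hm1 : pm.2 ≠ 1 := by
      intro h1; rw [h1, ArithmeticFunction.cardFactors_one] at hΩm; omega
    have hmin : (pm.1 * pm.2).minFac = pm.1 :=
      minFac_prime_mul hpp (sub_half_lt_natCast_iff.mp hminm)
    obtain ⟨p, m⟩ := pm
    simp only at hmin hp0 ⊢
    rw [Sigma.mk.inj_iff]
    refine ⟨hmin, ?_⟩
    rw [hmin, Nat.mul_div_cancel_left m hp0]
  · -- the summands agree
    intro q hq
    simp only
    rw [Nat.mul_div_cancel' (Nat.minFac_dvd q)]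

/-- **`stub_recursionIdentity`** (registered stub of skeleton v18, line `section-annihilator`): the exact Buchstab
recursion `C_{j+1}(𝒜; x, z) = Σ_{z < p ≤ x} C_j(𝒜_p; x/p, p − 1/2)` for rough cells (`j ≥ 1`) — the case `w = 1` of
`sum_roughCell_succ_eq_sum_fibre`. -/
theorem stub_recursionIdentity : RecursionIdentity := by
  intro 𝒜 x z j hj _hz
  have h := sum_roughCell_succ_eq_sum_fibre 𝒜 x z j hj (fun _ => 1)
  simp only [one_mul] at h
  rw [← h]
  rfl

end Summit.Parity.GeneralizedHardyLittlewood.Cruxes.CellParityLaw.SectionAnnihilator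

end
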